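import Summits.CriticalPhenomena.SAWScalingLimit.Theses.SAWDimerizationRG

/-!
# Costume certificate for route `SAWDimerizationRG` (crux-strategist r1, stmt-CriticalPhenomena-10693)

The route's deciding theorem is `closes (h₁ : CanonicalLimit) (h₂ : CanonicalToChordal) : SAWScalingLimit := h₂ h₁`
with `CanonicalToChordal := CanonicalLimit → SAWScalingLimit`.  The theorems below are kernel-checked facts
about the SHAPE of that reduction (no mathematics of SAW is used):

* `canonicalToChordal_of_summit` — the second load-bearing binder is a CONSEQUENCE of the summit conjunct
  (`S → (C → S)`), i.e. it is the summit weakened only by the extra hypothesis `CanonicalLimit`;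
* `closes_iff` — given the deciding crux `CanonicalLimit`, the remaining binder is EQUIVALENT to the summit
  conjunct: all of `SAWScalingLimit` is still to be proved after `CanonicalLimit` closes;
* `route_cone_iff` — the conjunction of the two load-bearing binders is equivalent to
  `CanonicalLimit ∧ SAWScalingLimit`: the route's cone is the summit conjunct PLUS an independent open
  problem, never less than the summit.
-/

namespace Summit.CriticalPhenomena.SAWScalingLimit.Cruxes.CanonicalLimit.Costume

open Summit.CriticalPhenomena.SAWScalingLimit.Theses.SAWDimerizationRG

/-- `S → CanonicalToChordal`: the bridge binder is implied by the summit conjunct outright. [folklore] -/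
theorem canonicalToChordal_of_summit : SAWScalingLimit → CanonicalToChordal :=
  fun hS _ => hS

/-- Given the deciding crux, the bridge binder IS the summit conjunct. [folklore] -/
theorem closes_iff (h₁ : CanonicalLimit) : CanonicalToChordal ↔ SAWScalingLimit :=
  ⟨fun h₂ => h₂ h₁, fun hS _ => hS⟩

/-- The load-bearing cone `CanonicalLimit ∧ CanonicalToChordal` is `CanonicalLimit ∧ SAWScalingLimit`. [folklore] -/
theorem route_cone_iff : (CanonicalLimit ∧ CanonicalToChordal) ↔ (CanonicalLimit ∧ SAWScalingLimit) :=
  ⟨fun ⟨h₁, h₂⟩ => ⟨h₁, h₂ h₁⟩, fun ⟨h₁, hS⟩ => ⟨h₁, fun _ => hS⟩⟩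

/-- The route's `Assembly` item is a tautology (modus ponens), independent of any SAW input. [folklore] -/
theorem assembly_trivial : Assembly := fun h₁ h₂ => h₂ h₁

end Summit.CriticalPhenomena.SAWScalingLimit.Cruxes.CanonicalLimit.Costume
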